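import Summits.HodgeConjecture.HodgeConjecture.Theorems.F0P3cStCharTSDomGeneral      -- ★ ED. 2 (this seat): `dominant_of_levels`, `exists_cmIwahoriDatum_levels`
import Summits.HodgeConjecture.HodgeConjecture.Theorems.F0P3cStCharTSTorusDefs       -- ★ p849564 terms of record: `torusChart`, `torusChartEntries` (+ ★ TorusCompactPart)
import Literature.NumberTheory.Automorphic.ValuedFieldValuativeRelBridge             -- ★ `v_lt_iff_valuation_lt`
import Literature.NumberTheory.Automorphic.LocalUnitaryIntegralLevel                  -- ★ `cmLocalIntegralLevel`, `mem_localIntegralLevel_iff_of_smul_eq`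
import HarnessLib

/-!
# F0 · P3c · line LH6 «StCharTS» — «DOM-BRIDGE★»: dominance at the torus-chart points `ι(m)` of `U(Φ₃)(L⁺_v)` for EVERY dominant `m`
# (`|m.1_w|_w < 1`), from the concrete levels of the CM Iwahori datum [Casselman1995, Prop. 1.4.3, Prop. 1.4.4; Rogawski1990, §12.2 p. 173]

Cell `pub/hodgecm-mathlib`, crux H413 = `stmt-HodgeConjecture-24833` (`--supports`, helper lane), route HCCMUnconditional; seat LH6-p05 (g2); road (D) owner LH6-p04 (g3)
(GO 2026-09-02T06:54:36Z on «DOM-GENERAL §2 ∕ N = 3 CM-side»).  THEOREMS ONLY, sorry-free, no def ∕ instance ∕ notation ∕ named fact.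
THE POINT.  ★ `F0P3cStCharTSDomGeneral.dominant_of_levels` (ED. 2) gives F1-G's `hbN ∕ hbNbar ∕ hbexh` at a torus element `b` whose MODEL image `e b` is a
dominant diagonal `glDiagonal 3 L_w d` (`|d_i∕d_j|_w ≤ q′ < 1`, `i < j`), for any Iwahori datum of ★ `cmBorelTriple L 3 v` with the concrete levels ∕ `N̄` of ★
`exists_cmIwahoriDatum_levels`.  The (SHF′) ∕ «SURJ-HECKE★» chain (★ `F0P3cStCharTSLevelFamily.shf_torusTransform_of_levelShells`, binder `hshell`) runs over the
torus CHART `ι(m) = d(α, z σ(α) α⁻¹, σ(α)⁻¹)` (`m = (α, z) ∈ E_v^× × E¹_v`, ★ `F0P3cStCharTSTorusDefs.torusChart`) at DOMINANT `m`: `|α_w|_w < 1`.  This file bridges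
the two currencies:
* §1 (model, `N = 3`): `ne_zero_of_coe_eq_diagonal_three`, **`exists_units_of_diagonal_lt_three`** — a diagonal `diag(e₀, e₁, e₂) ∈ U(σ,Φ₃)(K)` with
  `|e₀| < |e₁| < |e₂|` is `glDiagonal` of units with ratio bound `q′ = max(|e₀∕e₁|, |e₁∕e₂|)`, `0 ≠ q′ < 1` (twin of ★ `F0P3cIwahoriDatumU2.exists_units_of_diagonal_lt_two`);
* §2 (CM carrier): **`dominant_of_levels_of_diagonal`** (the triple at `b` with `e b = diag(e₀,e₁,e₂)`, `Valued.v e₀ < Valued.v e₁ < Valued.v e₂`),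
  `coe_localNonsplitEquiv_torusChart` (`e(ι m) = diag((ι m)ᵢᵢ(w))`), `valued_torusChartEntries_apply` (`|·|_w` of the three chart entries: `|α_w|, 1, |α_w|⁻¹`), and
  **`dominant_torusChart_of_levels`**: F1-G's `hbN ∕ hbNbar ∕ hbexh` at `b = ι(m)` for EVERY `m` with `|m.1_w|_w < 1` and every level — the `hF1`-side input of the
  `hshell` producer at a GENERAL dominant `u` ((SHF′) residue item (1));
* §3 **`level_le_cmLocalIntegralLevel`** — the `hK` binder of ★ `F0P3cStCharTSLevelFamily.shf_torusTransform_of_levelShells` («`∀ n, ∀ k ∈ 𝓘.K n, k ∈ U(Φ₃)(𝒪_v)`»)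
  for every datum whose levels lie in the (T1) compact open `K₀ = e⁻¹(U′ ∩ GL₃(𝒪_w))` (T1 clauses 5 + 12; ★ `mem_localIntegralLevel_iff_of_smul_eq`).
HONEST LABEL: count-neutral; HC_CM is proved only modulo the 7 printed citations (2 remaining: hLiu418 = stmt-HodgeConjecture-24832, h413 = stmt-HodgeConjecture-24833)
until rung 0 closes.

## References
* [Casselman1995] W. Casselman, *Introduction to the theory of admissible representations of `p`-adic reductive groups* (1995 notes), Prop. 1.4.3, Prop. 1.4.4.
* [Rogawski1990] J. D. Rogawski, *Automorphic Representations of Unitary Groups in Three Variables*, Ann. of Math. Stud. 123 (1990), §1.10 p. 9 (`M = {d(α,β,ᾱ⁻¹)}`),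
  §12.2 p. 173, §12.7 L. 12.7.1 (proof) p. 191.
* [PlatonovRapinchuk1994] V. Platonov, A. Rapinchuk, *Algebraic Groups and Number Theory* (1994), §5.1 (the one-place model at a non-split `v`).
-/

set_option autoImplicit false
-- the mandated namespace has the single-problem summit's repeated segment (`HodgeConjecture.HodgeConjecture`)
set_option linter.dupNamespace false

noncomputable section

open scoped MatrixGroups Pointwise Topology
open ValuativeRel Matrix
open Literature.NumberTheory.Automorphic Literature.NumberTheory.Automorphic.UnitaryGroup
open Summit.HodgeConjecture.HodgeConjecture.Cruxes.H413 Summit.HodgeConjecture.HodgeConjecture.Cruxes.H413.F0P3cStCharTSDomGeneral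

namespace Summit.HodgeConjecture.HodgeConjecture.Cruxes.H413.F0P3cStCharTSDomBridge

/-! ## §1 Model (`N = 3`): a diagonal with STRICTLY INCREASING valuations is dominant -/

section ModelThree

variable {K : Type*} [Field K] [ValuativeRel K] (σ : K →+* K) {J : Matrix (Fin 3) (Fin 3) K}

omit [ValuativeRel K] σ in
/-- The entries of an invertible diagonal `3 × 3` matrix are non-zero. [folklore] -/
theorem ne_zero_of_coe_eq_diagonal_three (s : GL (Fin 3) K) {e : Fin 3 → K} (hs : (s : Matrix (Fin 3) (Fin 3) K) = Matrix.diagonal e) (i : Fin 3) :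
    e i ≠ 0 := by
  have hdet : IsUnit (s : Matrix (Fin 3) (Fin 3) K).det := (Matrix.isUnit_iff_isUnit_det _).1 (Units.isUnit _)
  rw [hs, Matrix.det_diagonal] at hdet
  exact (IsUnit.ne_zero (isUnit_of_dvd_unit (Finset.dvd_prod_of_mem e (Finset.mem_univ i)) hdet))

/-- **A diagonal `diag(e₀, e₁, e₂)` with `|e₀| < |e₁| < |e₂|` is DOMINANT**: it is `glDiagonal` of units whose ratios `u_i∕u_j` (`i < j`) have valuation `≤ q′` with
`q′ := max(|e₀∕e₁|, |e₁∕e₂|)`, `0 ≠ q′ < 1` (the `s u hs hu` input of ★ `F0P3cIwahoriDatumU2.dominant_package` at `N = 3`; twin of ★ `exists_units_of_diagonal_lt_two`).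
[cite: Casselman1995, Prop. 1.4.3] -/
theorem exists_units_of_diagonal_lt_three (s : ↥(unitaryGroupOfForm σ J)) {e₀ e₁ e₂ : K}
    (hs : (((s : ↥(unitaryGroupOfForm σ J)) : GL (Fin 3) K) : Matrix (Fin 3) (Fin 3) K) = Matrix.diagonal ![e₀, e₁, e₂])
    (h01 : valuation K e₀ < valuation K e₁) (h12 : valuation K e₁ < valuation K e₂) :
    ∃ (u : Fin 3 → Kˣ) (q' : ValueGroupWithZero K), ((s : ↥(unitaryGroupOfForm σ J)) : GL (Fin 3) K) = glDiagonal 3 K u ∧ q' ≠ 0 ∧ q' < 1 ∧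
      ∀ i j : Fin 3, i < j → valuation K ((u i : K) * ((u j : K))⁻¹) ≤ q' := by
  have he₀ : e₀ ≠ 0 := ne_zero_of_coe_eq_diagonal_three _ hs 0
  have he₁ : e₁ ≠ 0 := ne_zero_of_coe_eq_diagonal_three _ hs 1
  have he₂ : e₂ ≠ 0 := ne_zero_of_coe_eq_diagonal_three _ hs 2
  have hv₀ : valuation K e₀ ≠ 0 := (Valuation.ne_zero_iff _).2 he₀
  have hv₁ : valuation K e₁ ≠ 0 := (Valuation.ne_zero_iff _).2 he₁
  have hv₂ : valuation K e₂ ≠ 0 := (Valuation.ne_zero_iff _).2 he₂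
  -- the two consecutive ratios
  have hr₁ : valuation K e₀ * (valuation K e₁)⁻¹ < 1 := by rw [mul_inv_lt_iff₀ (zero_lt_iff.2 hv₁), one_mul]; exact h01
  have hr₂ : valuation K e₁ * (valuation K e₂)⁻¹ < 1 := by rw [mul_inv_lt_iff₀ (zero_lt_iff.2 hv₂), one_mul]; exact h12
  refine ⟨![Units.mk0 e₀ he₀, Units.mk0 e₁ he₁, Units.mk0 e₂ he₂],
    max (valuation K e₀ * (valuation K e₁)⁻¹) (valuation K e₁ * (valuation K e₂)⁻¹), Units.ext ?_, ?_, max_lt hr₁ hr₂, ?_⟩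
  · rw [hs, coe_glDiagonal]
    congr 1
    funext k
    fin_cases k <;> rfl
  · exact fun h => (mul_ne_zero hv₀ (inv_ne_zero hv₁)) (le_antisymm (le_of_max_le_left h.le) zero_le)
  · intro i j hij
    fin_cases i <;> fin_cases j
    all_goals first | exact absurd hij (by decide) | skip
    · -- (0,1)
      show valuation K (e₀ * e₁⁻¹) ≤ _
      rw [map_mul, map_inv₀]; exact le_max_left _ _
    · -- (0,2): `|e₀∕e₂| = |e₀∕e₁|·|e₁∕e₂| ≤ q′·q′ ≤ q′`
      show valuation K (e₀ * e₂⁻¹) ≤ _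
      rw [map_mul, map_inv₀]
      have hsplit : valuation K e₀ * (valuation K e₂)⁻¹ = (valuation K e₀ * (valuation K e₁)⁻¹) * (valuation K e₁ * (valuation K e₂)⁻¹) := by
        rw [mul_assoc, ← mul_assoc ((valuation K e₁)⁻¹), inv_mul_cancel₀ hv₁, one_mul]
      rw [hsplit]
      calc (valuation K e₀ * (valuation K e₁)⁻¹) * (valuation K e₁ * (valuation K e₂)⁻¹)
          ≤ max (valuation K e₀ * (valuation K e₁)⁻¹) (valuation K e₁ * (valuation K e₂)⁻¹) * 1 :=
            mul_le_mul' (le_max_left _ _) hr₂.le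
        _ = _ := mul_one _
    · -- (1,2)
      show valuation K (e₁ * e₂⁻¹) ≤ _
      rw [map_mul, map_inv₀]; exact le_max_right _ _

end ModelThree

/-! ## §2 The CM carrier: the triple at `diag(e₀,e₁,e₂)`-points and at the torus chart `ι(m)` -/

section CMBridge

open scoped WithZero
open Literature.NumberTheory _root_.NumberField _root_.IsDedekindDomain
open Summit.HodgeConjecture.HodgeConjecture.Cruxes.H413.F0P3CMBorelIwahoriDatum

variable (L : Type) [Field L] [NumberField L] [IsCMField L] (v : HeightOneSpectrum (𝓞 ↥(maximalRealSubfield L)))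
  (w : PlacesOver L v) (hw : IsCMField.complexConj L • w.1 = w.1)

/-- **«DOM-GENERAL★» at a torus element with STRICTLY INCREASING model valuations** (`e b = diag(e₀, e₁, e₂)`, `|e₀|_w < |e₁|_w < |e₂|_w`): F1-G's `hbN ∕ hbNbar ∕ hbexh`
at `b` and every level, for any Iwahori datum with the concrete levels ∕ `N̄` of `exists_cmIwahoriDatum_levels` (`exists_units_of_diagonal_lt_three` + `dominant_of_levels`).
[cite: Casselman1995, Prop. 1.4.3, Prop. 1.4.4] [cite: PlatonovRapinchuk1994, §5.1] -/
theorem dominant_of_levels_of_diagonal (𝓘 : (cmBorelTriple L 3 v).IwahoriDatum) {γ₀ : ValueGroupWithZero (w.1.adicCompletion L)} (hγ₀0 : γ₀ ≠ 0) (hγ₀1 : γ₀ < 1)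
    (hK : ∀ n, 𝓘.K n = ((congruenceGL 3 (γ₀ ^ (n + 1))).comap (unitaryGroupOfForm (galAdicCompletionMap (L := L) (IsCMField.complexConj L) hw) (placeForm (Rogawski1990.qsForm L) w.1)).subtype).comap
        ((localNonsplitEquiv (IsCMField.complexConj L) (Rogawski1990.qsForm L) (IsCMField.complexConj_ne_one L) w hw) : ↥(«local» L (IsCMField.complexConj L) 3 (Rogawski1990.qsForm L) v) →* ↥(unitaryGroupOfForm (galAdicCompletionMap (L := L) (IsCMField.complexConj L) hw) (placeForm (Rogawski1990.qsForm L) w.1))))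
    (hNbar : 𝓘.Nbar = (((borelTriple (galAdicCompletionMap (L := L) (IsCMField.complexConj L) hw) (placeForm (Rogawski1990.qsForm L) w.1) (placeForm_qsForm_eq L v w)).N).map (MulAut.conj (weylLongU (galAdicCompletionMap (L := L) (IsCMField.complexConj L) hw) (placeForm_qsForm_eq L v w))).toMonoidHom).comap
        ((localNonsplitEquiv (IsCMField.complexConj L) (Rogawski1990.qsForm L) (IsCMField.complexConj_ne_one L) w hw) : ↥(«local» L (IsCMField.complexConj L) 3 (Rogawski1990.qsForm L) v) →* ↥(unitaryGroupOfForm (galAdicCompletionMap (L := L) (IsCMField.complexConj L) hw) (placeForm (Rogawski1990.qsForm L) w.1))))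
    (b : ↥(unitaryGroupOfForm (conjLocal L (IsCMField.complexConj L) v) (cmLocalForm L 3 v))) {e₀ e₁ e₂ : w.1.adicCompletion L}
    (hb : ((((localNonsplitEquiv (IsCMField.complexConj L) (Rogawski1990.qsForm L) (IsCMField.complexConj_ne_one L) w hw) b : ↥(unitaryGroupOfForm (galAdicCompletionMap (L := L) (IsCMField.complexConj L) hw) (placeForm (Rogawski1990.qsForm L) w.1))) : GL (Fin 3) (w.1.adicCompletion L)) : Matrix (Fin 3) (Fin 3) (w.1.adicCompletion L)) = Matrix.diagonal ![e₀, e₁, e₂])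
    (h01 : Valued.v e₀ < Valued.v e₁) (h12 : Valued.v e₁ < Valued.v e₂) (n : ℕ) :
    (∀ x ∈ 𝓘.K n ⊓ (cmBorelTriple L 3 v).N, b * x * b⁻¹ ∈ 𝓘.K n) ∧
    (∀ x ∈ 𝓘.K n ⊓ 𝓘.Nbar, b⁻¹ * x * b ∈ 𝓘.K n ⊓ 𝓘.Nbar) ∧
    (∀ x ∈ (cmBorelTriple L 3 v).N, ∃ m : ℕ, ∀ m', m ≤ m' → b ^ m' * x * (b ^ m')⁻¹ ∈ 𝓘.K n) := by
  obtain ⟨d, q', hd, hq'0, hq'1, hratio⟩ := exists_units_of_diagonal_lt_three (galAdicCompletionMap (L := L) (IsCMField.complexConj L) hw) _ hb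
    ((v_lt_iff_valuation_lt _ _).1 h01) ((v_lt_iff_valuation_lt _ _).1 h12)
  exact dominant_of_levels L v w hw 𝓘 hγ₀0 hγ₀1 hK hNbar b hq'0 hq'1 d hd hratio n

/-- **The model image of the torus chart**: `e(ι m) = diag((ι m)₀₀(w), (ι m)₁₁(w), (ι m)₂₂(w))` with `(ι m)ᵢᵢ = torusChartEntries m i = (α, z σ(α) α⁻¹, σ(α)⁻¹)ᵢ`
(★ `coe_torusChart`, ★ `localNonsplitEquiv_apply_apply`). [cite: Rogawski1990, §12.2 p. 173] [cite: PlatonovRapinchuk1994, §5.1] -/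
theorem coe_localNonsplitEquiv_torusChart (m : ((LocalRing L v)ˣ × ↥(normOneUnits (conjLocal L (IsCMField.complexConj L) v)))) :
    ((((localNonsplitEquiv (IsCMField.complexConj L) (Rogawski1990.qsForm L) (IsCMField.complexConj_ne_one L) w hw) ((F0P3cStCharTSTorusDefs.torusChart L v m : ↥(cmBorelTriple L 3 v).M) : ↥(unitaryGroupOfForm (conjLocal L (IsCMField.complexConj L) v) (cmLocalForm L 3 v))) : ↥(unitaryGroupOfForm (galAdicCompletionMap (L := L) (IsCMField.complexConj L) hw) (placeForm (Rogawski1990.qsForm L) w.1))) :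
        GL (Fin 3) (w.1.adicCompletion L)) : Matrix (Fin 3) (Fin 3) (w.1.adicCompletion L)) =
      Matrix.diagonal (fun i => ((F0P3cStCharTSTorusDefs.torusChartEntries L v m i : (LocalRing L v)ˣ) : LocalRing L v) w) := by
  refine Matrix.ext fun i j => ?_
  rw [localNonsplitEquiv_apply_apply]
  have hmat : Units.val (((F0P3cStCharTSTorusDefs.torusChart L v m : ↥(cmBorelTriple L 3 v).M) :
      ↥(unitaryGroupOfForm (conjLocal L (IsCMField.complexConj L) v) (cmLocalForm L 3 v))) : GL (Fin 3) (LocalRing L v)) =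
      Matrix.diagonal (fun k => ((F0P3cStCharTSTorusDefs.torusChartEntries L v m k : (LocalRing L v)ˣ) : LocalRing L v)) := by
    rw [F0P3cStCharTSTorusDefs.coe_torusChart, coe_glDiagonal]
  rw [hmat]
  by_cases hij : i = j
  · subst hij
    rw [Matrix.diagonal_apply_eq, Matrix.diagonal_apply_eq]
  · rw [Matrix.diagonal_apply_ne _ hij, Matrix.diagonal_apply_ne _ hij, Pi.zero_apply]

include hw in
/-- **The valuations of the chart entries at a non-split `w`**: `|(ι m)₀₀|_w = |α_w|`, `|(ι m)₁₁|_w = 1`, `|(ι m)₂₂|_w = |α_w|⁻¹` (`m = (α, z)`, `|z_w| = 1`, `|σ(α)_w| = |α_w|`).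
[cite: Rogawski1990, §12.2 p. 173] [cite: PlatonovRapinchuk1994, §5.1] -/
theorem valued_torusChartEntries_apply (m : ((LocalRing L v)ˣ × ↥(normOneUnits (conjLocal L (IsCMField.complexConj L) v)))) :
    Valued.v (((F0P3cStCharTSTorusDefs.torusChartEntries L v m 0 : (LocalRing L v)ˣ) : LocalRing L v) w) = Valued.v ((m.1 : LocalRing L v) w) ∧
    Valued.v (((F0P3cStCharTSTorusDefs.torusChartEntries L v m 1 : (LocalRing L v)ˣ) : LocalRing L v) w) = 1 ∧
    Valued.v (((F0P3cStCharTSTorusDefs.torusChartEntries L v m 2 : (LocalRing L v)ˣ) : LocalRing L v) w) = (Valued.v ((m.1 : LocalRing L v) w))⁻¹ := by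
  haveI := PlacesOver.subsingleton_of_smul_eq (IsCMField.complexConj L) (IsCMField.complexConj_ne_one L) w hw
  have hns : ∀ w' : PlacesOver L v, IsCMField.complexConj L • w'.1 = w'.1 := fun w' => by rw [Subsingleton.elim w' w]; exact hw
  -- the ingredients: `|α_w| ≠ 0`, `|z_w| = 1`, `|σ(α)_w| = |α_w|`, `|(u⁻¹)_w| = |u_w|⁻¹`
  have hne : ∀ u : (LocalRing L v)ˣ, (u : LocalRing L v) w ≠ 0 := fun u => by
    have h1 : ((u⁻¹ : (LocalRing L v)ˣ) : LocalRing L v) w * (u : LocalRing L v) w = 1 := by rw [← Pi.mul_apply, Units.inv_mul, Pi.one_apply]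
    exact right_ne_zero_of_mul_eq_one h1
  have hα0 : Valued.v ((m.1 : LocalRing L v) w) ≠ 0 := (Valuation.ne_zero_iff _).2 (hne m.1)
  have hz : Valued.v (((m.2 : (LocalRing L v)ˣ) : LocalRing L v) w) = 1 :=
    F0P3cStCharTSTorusCompactPart.valued_apply_eq_one_of_mem_normOneUnits L v hns m.2.2 w
  have hσ : ∀ u : (LocalRing L v)ˣ, Valued.v ((Units.map ((conjLocal L (IsCMField.complexConj L) v : LocalRing L v →+* LocalRing L v) :
      LocalRing L v →* LocalRing L v) u : LocalRing L v) w) = Valued.v ((u : LocalRing L v) w) := fun u => by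
    rw [Units.coe_map, MonoidHom.coe_coe, conjLocal_apply_eq_of_smul_eq (IsCMField.complexConj L) (IsCMField.complexConj_ne_one L) v w hw,
      valued_galAdicCompletionMap]
  have hinv : ∀ u : (LocalRing L v)ˣ, Valued.v (((u⁻¹ : (LocalRing L v)ˣ) : LocalRing L v) w) = (Valued.v ((u : LocalRing L v) w))⁻¹ := fun u => by
    have h1 : ((u⁻¹ : (LocalRing L v)ˣ) : LocalRing L v) w * (u : LocalRing L v) w = 1 := by rw [← Pi.mul_apply, Units.inv_mul, Pi.one_apply]
    have h2 := congrArg Valued.v h1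
    rw [map_mul, map_one] at h2
    exact eq_inv_of_mul_eq_one_left h2
  refine ⟨rfl, ?_, ?_⟩
  · show Valued.v ((((m.2 : (LocalRing L v)ˣ) * Units.map ((conjLocal L (IsCMField.complexConj L) v : LocalRing L v →+* LocalRing L v) :
        LocalRing L v →* LocalRing L v) m.1 * m.1⁻¹ : (LocalRing L v)ˣ) : LocalRing L v) w) = 1
    rw [Units.val_mul, Units.val_mul, Pi.mul_apply, Pi.mul_apply, map_mul, map_mul, hz, hσ, hinv, one_mul, mul_inv_cancel₀ hα0]
  · show Valued.v ((((Units.map ((conjLocal L (IsCMField.complexConj L) v : LocalRing L v →+* LocalRing L v) : LocalRing L v →* LocalRing L v) m.1)⁻¹ :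
        (LocalRing L v)ˣ) : LocalRing L v) w) = _
    rw [hinv, hσ]

/-- **«DOM-GENERAL★» AT `b = ι(m)` FOR EVERY DOMINANT `m`** (the (SHF′) ∕ «SURJ-HECKE★» currency: `|m.1_w|_w < 1`): F1-G's `hbN ∕ hbNbar ∕ hbexh` at the torus-chart point
`ι m ∈ T(L⁺_v)` and every level `n`, for any Iwahori datum with the concrete levels ∕ `N̄` of `exists_cmIwahoriDatum_levels` — the `hF1`-side input of the
`hshell` producer at a GENERAL dominant `u` (item (1) of the (SHF′) residue). [cite: Casselman1995, Prop. 1.4.3, Prop. 1.4.4] [cite: Rogawski1990, §12.2 p. 173; §12.7 L. 12.7.1 (proof) p. 191] -/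
theorem dominant_torusChart_of_levels (𝓘 : (cmBorelTriple L 3 v).IwahoriDatum) {γ₀ : ValueGroupWithZero (w.1.adicCompletion L)} (hγ₀0 : γ₀ ≠ 0) (hγ₀1 : γ₀ < 1)
    (hK : ∀ n, 𝓘.K n = ((congruenceGL 3 (γ₀ ^ (n + 1))).comap (unitaryGroupOfForm (galAdicCompletionMap (L := L) (IsCMField.complexConj L) hw) (placeForm (Rogawski1990.qsForm L) w.1)).subtype).comap
        ((localNonsplitEquiv (IsCMField.complexConj L) (Rogawski1990.qsForm L) (IsCMField.complexConj_ne_one L) w hw) : ↥(«local» L (IsCMField.complexConj L) 3 (Rogawski1990.qsForm L) v) →* ↥(unitaryGroupOfForm (galAdicCompletionMap (L := L) (IsCMField.complexConj L) hw) (placeForm (Rogawski1990.qsForm L) w.1))))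
    (hNbar : 𝓘.Nbar = (((borelTriple (galAdicCompletionMap (L := L) (IsCMField.complexConj L) hw) (placeForm (Rogawski1990.qsForm L) w.1) (placeForm_qsForm_eq L v w)).N).map (MulAut.conj (weylLongU (galAdicCompletionMap (L := L) (IsCMField.complexConj L) hw) (placeForm_qsForm_eq L v w))).toMonoidHom).comap
        ((localNonsplitEquiv (IsCMField.complexConj L) (Rogawski1990.qsForm L) (IsCMField.complexConj_ne_one L) w hw) : ↥(«local» L (IsCMField.complexConj L) 3 (Rogawski1990.qsForm L) v) →* ↥(unitaryGroupOfForm (galAdicCompletionMap (L := L) (IsCMField.complexConj L) hw) (placeForm (Rogawski1990.qsForm L) w.1))))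
    (m : ((LocalRing L v)ˣ × ↥(normOneUnits (conjLocal L (IsCMField.complexConj L) v)))) (hdom : Valued.v ((m.1 : LocalRing L v) w) < 1) (n : ℕ) :
    (∀ x ∈ 𝓘.K n ⊓ (cmBorelTriple L 3 v).N,
        ((F0P3cStCharTSTorusDefs.torusChart L v m : ↥(cmBorelTriple L 3 v).M) : ↥(unitaryGroupOfForm (conjLocal L (IsCMField.complexConj L) v) (cmLocalForm L 3 v))) * x *
          ((F0P3cStCharTSTorusDefs.torusChart L v m : ↥(cmBorelTriple L 3 v).M) : ↥(unitaryGroupOfForm (conjLocal L (IsCMField.complexConj L) v) (cmLocalForm L 3 v)))⁻¹ ∈ 𝓘.K n) ∧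
    (∀ x ∈ 𝓘.K n ⊓ 𝓘.Nbar,
        ((F0P3cStCharTSTorusDefs.torusChart L v m : ↥(cmBorelTriple L 3 v).M) : ↥(unitaryGroupOfForm (conjLocal L (IsCMField.complexConj L) v) (cmLocalForm L 3 v)))⁻¹ * x *
          ((F0P3cStCharTSTorusDefs.torusChart L v m : ↥(cmBorelTriple L 3 v).M) : ↥(unitaryGroupOfForm (conjLocal L (IsCMField.complexConj L) v) (cmLocalForm L 3 v))) ∈ 𝓘.K n ⊓ 𝓘.Nbar) ∧
    (∀ x ∈ (cmBorelTriple L 3 v).N, ∃ k : ℕ, ∀ k', k ≤ k' →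
        ((F0P3cStCharTSTorusDefs.torusChart L v m : ↥(cmBorelTriple L 3 v).M) : ↥(unitaryGroupOfForm (conjLocal L (IsCMField.complexConj L) v) (cmLocalForm L 3 v))) ^ k' * x *
          (((F0P3cStCharTSTorusDefs.torusChart L v m : ↥(cmBorelTriple L 3 v).M) : ↥(unitaryGroupOfForm (conjLocal L (IsCMField.complexConj L) v) (cmLocalForm L 3 v))) ^ k')⁻¹ ∈ 𝓘.K n) := by
  obtain ⟨h0, h1, h2⟩ := valued_torusChartEntries_apply L v w hw m
  have hα0 : Valued.v ((m.1 : LocalRing L v) w) ≠ 0 := by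
    refine (Valuation.ne_zero_iff _).2 fun h => ?_
    have h1' : ((m.1⁻¹ : (LocalRing L v)ˣ) : LocalRing L v) w * (m.1 : LocalRing L v) w = 1 := by rw [← Pi.mul_apply, Units.inv_mul, Pi.one_apply]
    rw [h, mul_zero] at h1'
    exact zero_ne_one h1'
  have hb := coe_localNonsplitEquiv_torusChart L v w hw m
  have hfun : (fun i => ((F0P3cStCharTSTorusDefs.torusChartEntries L v m i : (LocalRing L v)ˣ) : LocalRing L v) w) =
      ![((F0P3cStCharTSTorusDefs.torusChartEntries L v m 0 : (LocalRing L v)ˣ) : LocalRing L v) w,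
        ((F0P3cStCharTSTorusDefs.torusChartEntries L v m 1 : (LocalRing L v)ˣ) : LocalRing L v) w,
        ((F0P3cStCharTSTorusDefs.torusChartEntries L v m 2 : (LocalRing L v)ˣ) : LocalRing L v) w] := by
    funext i; fin_cases i <;> rfl
  rw [hfun] at hb
  refine dominant_of_levels_of_diagonal L v w hw 𝓘 hγ₀0 hγ₀1 hK hNbar _ hb ?_ ?_ n
  · rw [h0, h1]; exact hdom
  · rw [h1, h2]; exact one_lt_inv₀ (zero_lt_iff.2 hα0) |>.2 hdom

/-! ## §3 The `hK` binder of the (SHF′) glue: the levels lie in `U(Φ₃)(𝒪_v)` -/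

/-- **`K_n ≤ U(Φ₃)(𝒪_v)` for every datum whose levels lie in the (T1) compact open `K₀ = e⁻¹(U′ ∩ GL₃(𝒪_w))`** (T1 ∕ `exists_cmIwahoriDatum_levels` clauses 5 and 12):
the `hK` binder of ★ `F0P3cStCharTSLevelFamily.shf_torusTransform_of_levelShells` VERBATIM (`cmLocalIntegralLevel` read through the one-place model by ★
`mem_localIntegralLevel_iff_of_smul_eq`). [cite: PlatonovRapinchuk1994, §5.1] [cite: Rogawski1990, §12.2 p. 173] -/
theorem level_le_cmLocalIntegralLevel (𝓘 : (cmBorelTriple L 3 v).IwahoriDatum) (K₀ : Subgroup ↥(unitaryGroupOfForm (conjLocal L (IsCMField.complexConj L) v) (cmLocalForm L 3 v))) (hKle : ∀ n, 𝓘.K n ≤ K₀)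
    (hK₀ : ∀ k : ↥(unitaryGroupOfForm (conjLocal L (IsCMField.complexConj L) v) (cmLocalForm L 3 v)), k ∈ K₀ ↔
      ((((localNonsplitEquiv (IsCMField.complexConj L) (Rogawski1990.qsForm L) (IsCMField.complexConj_ne_one L) w hw) k : ↥(unitaryGroupOfForm (galAdicCompletionMap (L := L) (IsCMField.complexConj L) hw) (placeForm (Rogawski1990.qsForm L) w.1))) : GL (Fin 3) (w.1.adicCompletion L)) ∈ glInt 3 (w.1.adicCompletion L))) :
    ∀ n, ∀ k ∈ 𝓘.K n, k ∈ cmLocalIntegralLevel L 3 (Matrix.of fun i j : Fin 3 => if i.val + j.val + 1 = 3 then (1 : L) else 0) v := by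
  haveI : Algebra.IsQuadraticExtension ↥(maximalRealSubfield L) L := IsCMField.isQuadraticExtension L
  intro n k hk
  exact (mem_localIntegralLevel_iff_of_smul_eq (IsCMField.complexConj L) 3 (Rogawski1990.qsForm L) (IsCMField.complexConj_ne_one L) w hw k).2
    ((hK₀ k).1 (hKle n hk))

end CMBridge

end Summit.HodgeConjecture.HodgeConjecture.Cruxes.H413.F0P3cStCharTSDomBridge

end
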